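import Literature.NumberTheory.NumberFields.TotallyPositivePrescribedSquareClass
import HarnessLib

/-!
# Elements of a number field with PRESCRIBED SIGNS at the real embeddings and prescribed local square classes

Topic `NumberTheory/NumberFields`; namespace `Literature.NumberTheory.NumberFields`.  THEOREMS ONLY (no definition, no named fact,
no instance, no notation, no `sorry`).  The sign-general twin of ★ `exists_totallyPositive_forall_isSquare_div`
(`TotallyPositivePrescribedSquareClass`): for a finite set `S` of finite places of `K`, units `κ_v ∈ K_vˣ` (`v ∈ S`) and ANY
prescription of signs at the real embeddings — given as non-zero reference reals `r_φ` (`φ : K →+* ℝ`) — there is `t ∈ Kˣ` with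
`r_φ · φ(t) > 0` for every `φ` (i.e. `φ(t)` has the sign of `r_φ`) and `t / κ_v ∈ (K_v)²` for every `v ∈ S`
(`exists_sign_forall_isSquare_div`; one place: `exists_sign_isSquare_div`, `exists_sign_eq_mul_sq`; same-sign-as-a-given-element form:
`exists_sameSign_forall_isSquare_div`).  Proof = weak approximation at `S ∪ ∞` (★ `GaloisRepresentations.denseRange_algebraMap_pi_prod`,
[CasselsFrohlichANT1967, Ch. II §6]) for the open set «`v(x − κ_v) < v(4κ_v)` at `v ∈ S`, `r_w · x > 0` at the real places, `x ≠ 0` at the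
complex ones», and «local squares are open» (★ `QuadraticForms.isSquare_div_of_valued_sub_lt`, [Omeara1963, §63A Cor. 63:1b]) — the ★ proof with
the positive cone replaced by the prescribed open half-lines.  Since squares are local norms from every quadratic extension, `t ≡ κ_v` modulo
`Nm_{E_w/K_v} E_wˣ` as well.  Cell hodgecm-mathlib use (crux H413, line LH10 «(D-b)ᵀ», organ (WAᴸ)): a GLOBAL hermitian line `⟨t⟩` in a
prescribed local class at one non-split place (the supercuspidal theta class of [GelbartRogawski1991, Lem. 5.1.2]) with the real signs that make
`t · δ′` a `μ`-admissible element [Liu2021, Def. 4.12] (signs at the places of the CM type).  HC_CM is proved only modulo the printed citations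
until rung 0 closes; this file discharges none of them.

## References
* [CasselsFrohlichANT1967] J. W. S. Cassels, A. Fröhlich (eds.), *Algebraic Number Theory* (1967), Ch. II §6 (weak approximation).
* [Omeara1963] O. T. O'Meara, *Introduction to quadratic forms* (1963), §63A Cor. 63:1b (`F_𝔭²` is open).
* [NeukirchANT1999] J. Neukirch, *Algebraic Number Theory* (1999), Ch. III §1 (infinite primes and embeddings).
* [Liu2021] Y. Liu, Camb. J. Math. 9 (2021), Def. 4.12.  [GelbartRogawski1991] Invent. Math. 105 (1991), Lem. 5.1.2 p. 466.
-/

noncomputable section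

open NumberField IsDedekindDomain Valued Filter Topology

namespace Literature.NumberTheory.NumberFields

variable {K : Type} [Field K] [NumberField K]

/-! ## §1 Prescribed signs and prescribed local square classes -/

omit [NumberField K] in
/-- The isomorphism `K_w ≃+* ℝ` at a real place restricted to `K` is the real embedding `σ_w` (Mathlib
`Completion.extensionEmbeddingOfIsReal_coe`, restated for `algebraMap K K_w`; private plumbing). [folklore] -/
private theorem ringEquivRealOfIsReal_algebraMap'' {w : InfinitePlace K} (hw : w.IsReal) (a : K) :
    InfinitePlace.Completion.ringEquivRealOfIsReal hw (algebraMap K w.Completion a) =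
      InfinitePlace.embedding_of_isReal hw a := by
  rw [InfinitePlace.Completion.ringEquivRealOfIsReal_apply, InfinitePlace.Completion.algebraMap_apply]
  simp only [InfinitePlace.Completion.extensionEmbeddingOfIsReal_coe, WithAbs.equiv_apply]

/-- **Weak approximation with squares and PRESCRIBED signs.**  For a finite set `S` of finite places of the number field `K`, units
`κ_v ∈ K_vˣ` (`v ∈ S`) and non-zero reference reals `r_φ` at the real embeddings `φ : K →+* ℝ`, there is `t ∈ Kˣ` with `r_φ · φ(t) > 0` for
every `φ` (so `φ(t)` has the sign of `r_φ`) and `t / κ_v` a square in `K_v` for every `v ∈ S`: approximate `(κ_v)_v` at `S` within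
`v(x − κ_v) < v(4κ_v)` (then `x/κ_v ∈ K_v²`, [Omeara1963, 63:1b]) and a vector with the prescribed signs at the real places, by weak approximation
[CasselsFrohlichANT1967, Ch. II §6]. [cite: CasselsFrohlichANT1967, Ch. II §6 Lemma (weak approximation)] [cite: Omeara1963, §63A Cor. 63:1b] -/
theorem exists_sign_at_isReal_forall_isSquare_div (S : Finset (HeightOneSpectrum (𝓞 K)))
    (κ : ∀ v : HeightOneSpectrum (𝓞 K), (v.adicCompletion K)ˣ) (r : InfinitePlace K → ℝ) (hr : ∀ w, w.IsReal → r w ≠ 0) :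
    ∃ t : Kˣ, (∀ (w : InfinitePlace K) (hw : w.IsReal), 0 < r w * InfinitePlace.embedding_of_isReal hw (t : K)) ∧
      ∀ v ∈ S, IsSquare (algebraMap K (v.adicCompletion K) (t : K) / (κ v : v.adicCompletion K)) := by
  classical
  -- the neighbourhoods
  let U : ∀ v : (S : Type), Set (v.1.adicCompletion K) :=
    fun v ↦ {x | Valued.v (x - (κ v.1 : v.1.adicCompletion K)) < Valued.v (4 * (κ v.1 : v.1.adicCompletion K))}
  -- the target sign at a real place `w`: that of `r w`
  let V : ∀ w : InfinitePlace K, Set w.Completion := fun w ↦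
    if hw : w.IsReal then {x | 0 < r w * InfinitePlace.Completion.ringEquivRealOfIsReal hw x} else {x | x ≠ 0}
  -- the centre of the archimedean neighbourhood: `r w` itself read in `K_w` (resp. `1` at a complex place)
  let c : ∀ w : InfinitePlace K, w.Completion := fun w ↦
    if hw : w.IsReal then (InfinitePlace.Completion.ringEquivRealOfIsReal hw).symm (r w) else 1
  have hU : ∀ v : (S : Type), U v ∈ 𝓝 (κ v.1 : v.1.adicCompletion K) := by
    intro v
    haveI : CharZero (v.1.adicCompletion K) := charZero_of_injective_algebraMap (algebraMap K _).injective
    have h4 : (4 : v.1.adicCompletion K) ≠ 0 := by norm_num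
    have hne : Valued.v.restrict (4 * (κ v.1 : v.1.adicCompletion K)) ≠ 0 := by simp [h4, (κ v.1).ne_zero]
    rw [Valued.mem_nhds]
    refine ⟨Units.mk0 _ hne, fun y hy ↦ ?_⟩
    rw [Set.mem_setOf_eq, Units.val_mk0] at hy
    exact Valued.v.restrict_lt_iff.mp hy
  have hV : ∀ w : InfinitePlace K, V w ∈ 𝓝 (c w) := by
    intro w
    by_cases hw : w.IsReal
    · simp only [V, c, dif_pos hw]
      have hcont : Continuous (InfinitePlace.Completion.ringEquivRealOfIsReal hw) :=
        (InfinitePlace.Completion.isometryEquivRealOfIsReal hw).continuous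
      refine (isOpen_lt continuous_const (continuous_const.mul hcont)).mem_nhds ?_
      change 0 < r w *
        InfinitePlace.Completion.ringEquivRealOfIsReal hw ((InfinitePlace.Completion.ringEquivRealOfIsReal hw).symm (r w))
      rw [RingEquiv.apply_symm_apply]
      exact mul_self_pos.2 (hr w hw)
    · simp only [V, c, dif_neg hw]
      exact isOpen_ne.mem_nhds one_ne_zero
  have hUpi : Set.pi Set.univ U ∈ 𝓝 (fun v : (S : Type) ↦ (κ v.1 : v.1.adicCompletion K)) :=
    set_pi_mem_nhds Set.finite_univ fun v _ ↦ hU v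
  have hVpi : Set.pi Set.univ V ∈ 𝓝 (fun w : InfinitePlace K ↦ c w) :=
    set_pi_mem_nhds Set.finite_univ fun w _ ↦ hV w
  have hprod : (Set.pi Set.univ U) ×ˢ (Set.pi Set.univ V) ∈
      𝓝 ((fun v : (S : Type) ↦ (κ v.1 : v.1.adicCompletion K)), (fun w : InfinitePlace K ↦ c w)) :=
    prod_mem_nhds hUpi hVpi
  -- weak approximation
  obtain ⟨_, ⟨⟨k, rfl⟩, hkU, hkV⟩⟩ :=
    (GaloisRepresentations.denseRange_algebraMap_pi_prod (K := K) S).inter_nhds_nonempty hprod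
  simp only [Set.mem_pi, Set.mem_univ, forall_const] at hkU hkV
  have hkU' : ∀ v : (S : Type),
      Valued.v (algebraMap K (v.1.adicCompletion K) k - (κ v.1 : v.1.adicCompletion K)) <
        Valued.v (4 * (κ v.1 : v.1.adicCompletion K)) := fun v ↦ hkU v
  have hkV' : ∀ w : InfinitePlace K, algebraMap K w.Completion k ∈ V w := fun w ↦ hkV w
  -- the prescribed signs at the real places, read on the real embeddings
  have hsgn : ∀ (w : InfinitePlace K) (hw : w.IsReal), 0 < r w * InfinitePlace.embedding_of_isReal hw k := by
    intro w hw
    have h := hkV' w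
    simp only [V, dif_pos hw, Set.mem_setOf_eq] at h
    rwa [ringEquivRealOfIsReal_algebraMap''] at h
  -- `k ≠ 0` (look at any infinite place)
  obtain ⟨w₀⟩ : Nonempty (InfinitePlace K) := inferInstance
  have hk0 : k ≠ 0 := by
    rintro rfl
    have h := hkV' w₀
    rw [map_zero] at h
    by_cases hw : w₀.IsReal
    · have h' : (0 : ℝ) < r w₀ * InfinitePlace.Completion.ringEquivRealOfIsReal hw 0 := by
        simpa only [V, dif_pos hw, Set.mem_setOf_eq] using h
      rw [map_zero, mul_zero] at h'
      exact lt_irrefl _ h'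
    · have h' : (0 : w₀.Completion) ≠ 0 := by simpa only [V, dif_neg hw, Set.mem_setOf_eq] using h
      exact h' rfl
  refine ⟨Units.mk0 k hk0, fun w hw ↦ ?_, fun v hv ↦ ?_⟩
  · rw [Units.val_mk0]
    exact hsgn w hw
  · rw [Units.val_mk0]
    exact (QuadraticForms.isSquare_div_of_valued_sub_lt K v (κ v).ne_zero (hkU' ⟨v, hv⟩)).1

/-- **Weak approximation with squares and prescribed signs, the signs indexed by the real EMBEDDINGS `φ : K →+* ℝ`** (the real primes
ARE the real embeddings, ★ `embedding_of_isReal_mk_ofReal_comp`): for non-zero reference reals `r_φ` there is `t ∈ Kˣ` with `r_φ · φ(t) > 0` for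
every `φ` and `t / κ_v ∈ (K_v)²` for every `v ∈ S`. [cite: CasselsFrohlichANT1967, Ch. II §6 Lemma (weak approximation)] [cite: Omeara1963, §63A Cor. 63:1b] -/
theorem exists_sign_forall_isSquare_div (S : Finset (HeightOneSpectrum (𝓞 K)))
    (κ : ∀ v : HeightOneSpectrum (𝓞 K), (v.adicCompletion K)ˣ) (r : (K →+* ℝ) → ℝ) (hr : ∀ φ, r φ ≠ 0) :
    ∃ t : Kˣ, (∀ φ : K →+* ℝ, 0 < r φ * φ (t : K)) ∧
      ∀ v ∈ S, IsSquare (algebraMap K (v.adicCompletion K) (t : K) / (κ v : v.adicCompletion K)) := by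
  classical
  obtain ⟨t, ht, hsq⟩ := exists_sign_at_isReal_forall_isSquare_div S κ
    (fun w => if hw : w.IsReal then r (InfinitePlace.embedding_of_isReal hw) else 1)
    (fun w hw => by rw [dif_pos hw]; exact hr _)
  refine ⟨t, fun φ => ?_, hsq⟩
  obtain ⟨hw, hφ⟩ := embedding_of_isReal_mk_ofReal_comp φ
  have h := ht _ hw
  rw [dif_pos hw, hφ] at h
  exact h

/-- **Same-sign form**: for a reference element `a ∈ Kˣ` there is `t ∈ Kˣ` with `φ(t)` of the SAME SIGN as `φ(a)` at every real embedding (`0 < φ(a) · φ(t)`)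
and `t / κ_v ∈ (K_v)²` for every `v ∈ S` (`r_φ := φ(a)`). [cite: CasselsFrohlichANT1967, Ch. II §6 Lemma (weak approximation)] [cite: Omeara1963, §63A Cor. 63:1b] -/
theorem exists_sameSign_forall_isSquare_div (S : Finset (HeightOneSpectrum (𝓞 K)))
    (κ : ∀ v : HeightOneSpectrum (𝓞 K), (v.adicCompletion K)ˣ) (a : Kˣ) :
    ∃ t : Kˣ, (∀ φ : K →+* ℝ, 0 < φ (a : K) * φ (t : K)) ∧
      ∀ v ∈ S, IsSquare (algebraMap K (v.adicCompletion K) (t : K) / (κ v : v.adicCompletion K)) :=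
  exists_sign_forall_isSquare_div S κ (fun φ => φ (a : K)) fun φ => (map_ne_zero φ).2 a.ne_zero

/-- **One place.**  For a finite place `v`, `κ ∈ K_vˣ` and non-zero reference signs `r_φ` there is `t ∈ Kˣ` with `r_φ · φ(t) > 0` for every `φ` and
`t / κ ∈ K_v²`. [cite: CasselsFrohlichANT1967, Ch. II §6 Lemma (weak approximation)] [cite: Omeara1963, §63A Cor. 63:1b] -/
theorem exists_sign_isSquare_div (v : HeightOneSpectrum (𝓞 K)) (κ : (v.adicCompletion K)ˣ) (r : (K →+* ℝ) → ℝ)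
    (hr : ∀ φ, r φ ≠ 0) :
    ∃ t : Kˣ, (∀ φ : K →+* ℝ, 0 < r φ * φ (t : K)) ∧
      IsSquare (algebraMap K (v.adicCompletion K) (t : K) / (κ : v.adicCompletion K)) := by
  classical
  obtain ⟨t, ht, hsq⟩ :=
    exists_sign_forall_isSquare_div ({v} : Finset (HeightOneSpectrum (𝓞 K)))
      (Function.update (fun w : HeightOneSpectrum (𝓞 K) ↦ (1 : (w.adicCompletion K)ˣ)) v κ) r hr
  refine ⟨t, ht, ?_⟩
  have h := hsq v (Finset.mem_singleton_self v)
  rwa [Function.update_self] at h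

/-- **One place, unit form.**  For a finite place `v`, `κ ∈ K_vˣ` and non-zero reference signs `r_φ` there are `t ∈ Kˣ` with the prescribed signs and
`s ∈ K_vˣ` with `t = κ · s²` in `K_v` — `t` and `κ` have THE SAME SQUARE CLASS in `K_vˣ / (K_vˣ)²`, hence the same class modulo every norm group
`Nm_{E_w/K_v} E_wˣ ⊇ (K_vˣ)²`. [cite: CasselsFrohlichANT1967, Ch. II §6 Lemma (weak approximation)] [cite: Omeara1963, §63A Cor. 63:1b] -/
theorem exists_sign_eq_mul_sq (v : HeightOneSpectrum (𝓞 K)) (κ : (v.adicCompletion K)ˣ) (r : (K →+* ℝ) → ℝ) (hr : ∀ φ, r φ ≠ 0) :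
    ∃ (t : Kˣ) (s : (v.adicCompletion K)ˣ), (∀ φ : K →+* ℝ, 0 < r φ * φ (t : K)) ∧
      algebraMap K (v.adicCompletion K) (t : K) = (κ : v.adicCompletion K) * (s : v.adicCompletion K) ^ 2 := by
  obtain ⟨t, ht, u, hu⟩ := exists_sign_isSquare_div v κ r hr
  have ht0 : algebraMap K (v.adicCompletion K) (t : K) ≠ 0 := (map_ne_zero _).2 t.ne_zero
  have hu0 : u ≠ 0 := by
    rintro rfl
    rw [mul_zero, div_eq_zero_iff] at hu
    exact hu.elim ht0 (κ.ne_zero)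
  refine ⟨t, Units.mk0 u hu0, ht, ?_⟩
  rw [Units.val_mk0, sq, ← hu, mul_div_cancel₀ _ κ.ne_zero]

/-- **One place, same-sign unit form**: `t` with the signs of a reference `a ∈ Kˣ` at every real embedding and `t = κ · s²` in `K_v`.
[cite: CasselsFrohlichANT1967, Ch. II §6 Lemma (weak approximation)] [cite: Omeara1963, §63A Cor. 63:1b] -/
theorem exists_sameSign_eq_mul_sq (v : HeightOneSpectrum (𝓞 K)) (κ : (v.adicCompletion K)ˣ) (a : Kˣ) :
    ∃ (t : Kˣ) (s : (v.adicCompletion K)ˣ), (∀ φ : K →+* ℝ, 0 < φ (a : K) * φ (t : K)) ∧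
      algebraMap K (v.adicCompletion K) (t : K) = (κ : v.adicCompletion K) * (s : v.adicCompletion K) ^ 2 :=
  exists_sign_eq_mul_sq v κ (fun φ => φ (a : K)) fun φ => (map_ne_zero φ).2 a.ne_zero

end Literature.NumberTheory.NumberFields

end
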